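import Literature.AlgebraicGeometry.Morphisms.GraphFamilyBaseChange
import Mathlib.AlgebraicGeometry.IdealSheaf.Functorial
import Mathlib.AlgebraicGeometry.Gluing
import HarnessLib

/-!
# Factorisation through a closed subscheme and containment of ideal sheaves are LOCAL on the test scheme

Topic `Literature/AlgebraicGeometry/Morphisms`, namespace `Literature.AlgebraicGeometry.Morphisms`.  THEOREMS ONLY (no definition, no instance, no notation, no
named fact, no `sorry`); universe-polymorphic; Mathlib + ★ `Morphisms/ProjectiveSpaceOverBasePoints` (`projectiveSpaceMap`, `isPullback_projectiveSpaceMap`).  Cell `hodgecm-mathlib` (D-0151 ∕ FLOOR 0), P1 sub-line F-4 layer 2, sub-stub (II-b) (the Hom-SCHEME),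
brick **(b1) FILE 2A-α** of B-p20 (g14)'s blueprint `B-provers/B-p20/g14/BLUEPRINT-F4-IIb-b1-FILE2A.B-p20g14.md` §2 (4): the reduction of «`b : T′ → T` lands in the closed
subscheme `V(J)`» and of «`𝓘₁ ≤ 𝓘₂` on `𝐏(ι; T′)`» to an open cover of `T′`.  Count-neutral Mathlib-side capital; HC_CM is proved only modulo the 7 printed citations until
rung 0 closes — nothing here is about HC.

THE PRINT.  [GortzWedhorn2020] Prop. 3.5 ∕ (4.11) (gluing of morphisms; a morphism into a closed subscheme is determined locally on the source) and Exercise 3.25 (p. 93) ∕ Section (4.11) (p. 112)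
(`f` factors through `V(𝓘)` iff `𝓘 ≤ ker f^♯`); [Hartshorne1977] II Ex. 3.11 (a) and Ex. 2.12 (closed subschemes and base change, gluing).

* §1 **`le_ker_iff_forall_openCover`** — `J ≤ ker b^♯ ↔ ∀ k, J ≤ ker (u_k ≫ b)^♯` for an open cover `(u_k)` of `T′` (glue the local lifts, Mathlib
  `OpenCover.glueMorphisms`, `IsClosedImmersion.lift`); `le_ker_comp_of_le_ker` (the easy direction for any `u`).
* §2 **`le_of_forall_comap_le`** — `J₁ ≤ J₂ ↔ ∀ k, J₁.comap u_k ≤ J₂.comap u_k` for an open cover `(u_k)` of the ambient scheme (§1 applied to the closed immersion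
  `V(J₂) ↪ Y` and the pulled-back cover; Mathlib `le_map_iff_comap_le`, `map_ker`); `comap_mono` (the easy direction, any morphism); `comap_le_comap_iff_of_isIso`.
* §3 **`comap_projectiveSpaceMap_le_iff_forall_openCover`** — for ideal sheaves `J₁ J₂` on `𝐏(ι; T)` and `b : T′ → T`: «`J₁.comap 𝐏(b) ≤ J₂.comap 𝐏(b)`» (e.g.
  «`Z_{T′} ⊂ W_{T′}`» for closed `Z W ⊂ 𝐏(ι; T)`) iff the same holds for `u_k ≫ b` over an open cover `(u_k)` of `T′` (§2 over the cover `𝐏(ι; U_k)` of `𝐏(ι; T′)`,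
  ★ `isPullback_projectiveSpaceMap`, ★ `Morphisms/GraphFamilyBaseChange.projectiveSpaceMap_comp`).

## References
* [GortzWedhorn2020] U. Görtz, T. Wedhorn, *Algebraic Geometry I*, 2nd ed. (2020), Prop. 3.5 (p. 70), Exercise 3.25 (p. 93), Section (4.11) (p. 112), Prop. 4.20 (p. 104).
* [Hartshorne1977] R. Hartshorne, *Algebraic Geometry* (1977), II Ex. 2.12 (p. 80), II Ex. 3.11 (a) (p. 92).
* [StacksProject] The Stacks Project, Tag 01NF (base change of `𝐏ⁿ`).
-/

noncomputable section

-- `Morphisms.projectiveSpace ι T` is a `def` over Mathlib's `pullback` (as in ★ `Motives/HilbertImageInGrassmannianUniversalFamily`).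
set_option backward.isDefEq.respectTransparency false

universe u

open CategoryTheory CategoryTheory.Limits AlgebraicGeometry

namespace Literature.AlgebraicGeometry.Morphisms

/-! ## §1 `J ≤ ker b^♯` is local on the source of `b` -/

/-- The easy direction: `J ≤ ker b^♯ ⇒ J ≤ ker (u ≫ b)^♯` for any `u` (Mathlib `Scheme.Hom.le_ker_comp`). [cite: GortzWedhorn2020, Exercise 3.25 (p. 93)] -/
theorem le_ker_comp_of_le_ker {X T T' : Scheme.{u}} (J : X.IdealSheafData) (b : T ⟶ X) (u : T' ⟶ T) (h : J ≤ b.ker) :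
    J ≤ (u ≫ b).ker :=
  h.trans (u.le_ker_comp b)

/-- **`J ≤ ker b^♯` is local on the source**: for an open cover `(u_k : U_k → T)` of `T`, `J ≤ ker b^♯` iff `J ≤ ker (u_k ≫ b)^♯` for every `k` — each `u_k ≫ b`
lifts through the closed immersion `V(J) ↪ X` (Mathlib `IsClosedImmersion.lift`), the lifts agree on overlaps (`V(J) ↪ X` is a monomorphism) and glue (Mathlib
`OpenCover.glueMorphisms`), and a morphism factoring through `V(J)` kills `J`. [cite: GortzWedhorn2020, Prop. 3.5 (p. 70) and Exercise 3.25 (p. 93)] -/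
theorem le_ker_iff_forall_openCover {X T : Scheme.{u}} (J : X.IdealSheafData) (b : T ⟶ X) (𝒰 : T.OpenCover) :
    J ≤ b.ker ↔ ∀ k, J ≤ (𝒰.f k ≫ b).ker := by
  refine ⟨fun h k => le_ker_comp_of_le_ker J b (𝒰.f k) h, fun h => ?_⟩
  -- local lifts through `V(J) ↪ X`
  let g : ∀ k, 𝒰.X k ⟶ J.subscheme := fun k => IsClosedImmersion.lift J.subschemeι (𝒰.f k ≫ b) (by rw [J.ker_subschemeι]; exact h k)
  have hg : ∀ k, g k ≫ J.subschemeι = 𝒰.f k ≫ b := fun k => IsClosedImmersion.lift_fac _ _ _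
  have hcompat : ∀ k l, pullback.fst (𝒰.f k) (𝒰.f l) ≫ g k = pullback.snd (𝒰.f k) (𝒰.f l) ≫ g l := fun k l => by
    rw [← cancel_mono J.subschemeι, Category.assoc, Category.assoc, hg, hg, pullback.condition_assoc]
  have hglue : 𝒰.glueMorphisms g hcompat ≫ J.subschemeι = b :=
    Scheme.Cover.hom_ext 𝒰 _ _ fun k => by rw [Scheme.Cover.ι_glueMorphisms_assoc, hg]
  rw [← hglue]
  exact J.ker_subschemeι.ge.trans ((𝒰.glueMorphisms g hcompat).le_ker_comp J.subschemeι)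

/-! ## §2 Containment of ideal sheaves is local on the ambient scheme -/

/-- The easy direction: `J₁ ≤ J₂ ⇒ J₁.comap f ≤ J₂.comap f` for any `f` (the pulled-back closed subschemes are nested: Mathlib's Galois connection
`le_map_iff_comap_le` with `map_ker`). [cite: GortzWedhorn2020, Prop. 4.20 (p. 104)] -/
theorem comap_mono {X Y : Scheme.{u}} (f : X ⟶ Y) {J₁ J₂ : Y.IdealSheafData} (h : J₁ ≤ J₂) : J₁.comap f ≤ J₂.comap f := by
  change J₁.comap f ≤ (pullback.fst f J₂.subschemeι).ker
  rw [← Scheme.IdealSheafData.le_map_iff_comap_le, Scheme.IdealSheafData.map_ker, pullback.condition]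
  exact h.trans (J₂.ker_subschemeι.ge.trans ((pullback.snd f J₂.subschemeι).le_ker_comp J₂.subschemeι))

/-- **Containment of ideal sheaves is local**: for an open cover `(u_k : U_k → Y)` of `Y` and ideal sheaves `J₁ J₂` on `Y`, `J₁ ≤ J₂` iff
`J₁.comap u_k ≤ J₂.comap u_k` for every `k` (Mathlib `IdealSheafData.comap` = the ideal of the pulled-back closed subscheme).  Proof: `J₂ = ker (V(J₂) ↪ Y)^♯`, §1
for the cover of `V(J₂)` pulled back from `(u_k)`, and the Galois connection `le_map_iff_comap_le` ∕ `map_ker` on each piece.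
[cite: GortzWedhorn2020, Prop. 3.5 (p. 70) and Prop. 4.20 (p. 104)] [cite: Hartshorne1977, II Ex. 3.11 (a) (p. 92)] -/
theorem le_of_forall_comap_le {Y : Scheme.{u}} (𝒱 : Y.OpenCover) {J₁ J₂ : Y.IdealSheafData} :
    J₁ ≤ J₂ ↔ ∀ k, J₁.comap (𝒱.f k) ≤ J₂.comap (𝒱.f k) := by
  refine ⟨fun h k => comap_mono (𝒱.f k) h, fun h => ?_⟩
  rw [← J₂.ker_subschemeι, le_ker_iff_forall_openCover J₁ J₂.subschemeι (𝒱.pullback₁ J₂.subschemeι)]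
  intro k
  -- on the piece `V(J₂) ×_Y U_k`: from `J₁.comap u_k ≤ J₂.comap u_k = ker (U_k ×_Y V(J₂) → U_k)^♯`
  have hk : J₁ ≤ (pullback.fst (𝒱.f k) J₂.subschemeι ≫ 𝒱.f k).ker := by
    rw [← Scheme.IdealSheafData.map_ker, Scheme.IdealSheafData.le_map_iff_comap_le]
    exact h k
  rw [pullback.condition] at hk
  -- `pullback.fst J₂ι u_k ≫ J₂ι = (pullbackSymmetry).hom ≫ pullback.snd u_k J₂ι ≫ J₂ι`
  change J₁ ≤ (pullback.fst J₂.subschemeι (𝒱.f k) ≫ J₂.subschemeι).ker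
  rw [← pullbackSymmetry_hom_comp_snd J₂.subschemeι (𝒱.f k), Category.assoc, Scheme.Hom.ker_comp_of_isIso]
  exact hk

/-- **Pull-back along an isomorphism reflects containment of ideal sheaves** (`comap e.hom` followed by `comap e.inv` is the identity: Mathlib `comap_comp`, `comap_id`).
[cite: GortzWedhorn2020, Prop. 4.20 (p. 104)] -/
theorem comap_le_comap_iff_of_isIso {X Y : Scheme.{u}} (e : X ⟶ Y) [IsIso e] {J₁ J₂ : Y.IdealSheafData} :
    J₁.comap e ≤ J₂.comap e ↔ J₁ ≤ J₂ := by
  refine ⟨fun h => ?_, comap_mono e⟩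
  have h' := comap_mono (inv e) h
  rwa [← Scheme.IdealSheafData.comap_comp, ← Scheme.IdealSheafData.comap_comp, IsIso.inv_hom_id, Scheme.IdealSheafData.comap_id,
    Scheme.IdealSheafData.comap_id] at h'

/-! ## §3 Containment after base change along `𝐏(b)` is local on the test scheme -/

/-- **«`Z_{T′} ⊂ W_{T′}`» is local on `T′`.**  For ideal sheaves `J₁ J₂` on `𝐏(ι; T)`, `b : T′ → T` and an open cover `(u_k : U_k → T′)`:
`J₁.comap 𝐏(b) ≤ J₂.comap 𝐏(b)` iff `J₁.comap 𝐏(u_k ≫ b) ≤ J₂.comap 𝐏(u_k ≫ b)` for every `k` — §2 for the open cover of `𝐏(ι; T′)` by the `𝐏(ι; U_k) ≅ 𝐏(ι; T′) ×_{T′} U_k`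
(★ `isPullback_projectiveSpaceMap`), `comap_comp`, and `comap` along the comparison isomorphism. [cite: GortzWedhorn2020, Section (4.12) and Prop. 4.20 (p. 104)]
[cite: StacksProject, Tag 01NF] -/
theorem comap_projectiveSpaceMap_le_iff_forall_openCover (ι : Type u) {T T' : Scheme.{u}} (b : T' ⟶ T) (𝒰 : T'.OpenCover)
    {J₁ J₂ : (projectiveSpace ι T).IdealSheafData} :
    J₁.comap (projectiveSpaceMap ι b) ≤ J₂.comap (projectiveSpaceMap ι b) ↔
      ∀ k, J₁.comap (projectiveSpaceMap ι (𝒰.f k ≫ b)) ≤ J₂.comap (projectiveSpaceMap ι (𝒰.f k ≫ b)) := by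
  constructor
  · intro h k
    rw [projectiveSpaceMap_comp, Scheme.IdealSheafData.comap_comp, Scheme.IdealSheafData.comap_comp]
    exact comap_mono _ h
  · intro h
    rw [le_of_forall_comap_le (𝒰.pullback₁ (projectiveSpaceFst ι T'))]
    intro k
    -- the piece `𝐏(ι; T′) ×_{T′} U_k` is `𝐏(ι; U_k)` (★ `isPullback_projectiveSpaceMap`)
    have H := isPullback_projectiveSpaceMap ι (𝒰.f k)
    have he : H.isoPullback.inv ≫ projectiveSpaceMap ι (𝒰.f k) = pullback.fst (projectiveSpaceFst ι T') (𝒰.f k) := by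
      rw [Iso.inv_comp_eq, IsPullback.isoPullback_hom_fst]
    change (J₁.comap (projectiveSpaceMap ι b)).comap (pullback.fst (projectiveSpaceFst ι T') (𝒰.f k)) ≤
      (J₂.comap (projectiveSpaceMap ι b)).comap (pullback.fst (projectiveSpaceFst ι T') (𝒰.f k))
    rw [← he, Scheme.IdealSheafData.comap_comp, Scheme.IdealSheafData.comap_comp, comap_le_comap_iff_of_isIso,
      ← Scheme.IdealSheafData.comap_comp, ← Scheme.IdealSheafData.comap_comp, ← projectiveSpaceMap_comp]
    exact h k

end Literature.AlgebraicGeometry.Morphisms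

end
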